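import Summits.BirchSwinnertonDyer.BirchSwinnertonDyer.Theorems.KolyvaginRoadThreeMethod2RankLowering
import HarnessLib

/-!
# Route `KolyvaginRoadThree`, deciding crux `ZhangSharpFrameAtThreeHL` (item stmt-BirchSwinnertonDyer-19574):
# the (A1) RANK-LOWERING conjunct of the registered stub `stub_levelRaisingAtThree` — v2u text, ON GOOD LEVELS — for
# the canonical spaces `SelQ`, REDUCED to five local–global inputs at ONE GOOD (non-scalar) unipotent-admissible prime
# (cell `bsd-stepL`, seat `bsd-stepL-koly3a` g0, ACCEL-LIST (9); `--supports stmt-BirchSwinnertonDyer-19574`, helper)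

WHY THIS FILE. `Theorems/KolyvaginRoadThreeMethod2RankLowering.lean` (koly3a p460669) reduced the (A1) conjunct of the
v2t stub text — quantified over ALL finite sets of unipotent-admissible primes — to five inputs (Cheb), (Equiv),
(Line), (Trans), (Iso) asked at EVERY unipotent-admissible prime. The owner seat (koly g12, STUB-MISSTATED-3,
`koly/STUB-MISSTATED-3-19574-scalar.md`) then showed that `IsUAdmissiblePrime` also admits primes with SCALAR residual
Frobenius `ρ̄(Frob_q) = ±1`, at which `H¹(K_q, E[3])` is 4-dimensional, `H¹_fin` is a plane and the ordinary condition
is EVERYTHING — so (A1) over all levels is false, and so are (Line) ∕ (Trans) at a scalar prime (the v2t-shaped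
reduction stays a true but idle implication there). The registered skeleton is now v2u (koly g12 18:35Z, sha16
37ce476c): every level quantifier is relativised to GOOD levels `GoodLevel W K n` (all primes of `n` have
`Frob_q² ≠ 1` on `E[3]`, tree `Method2.FrobSqNeOneAt`, p460483), and (A1) must produce a GOOD prime. This file is the
matching reduction: the five inputs are asked ONLY at primes with `FrobSqNeOneAt W 3 q` (and (Cheb) must produce such
a prime; (Iso) only on good levels), where they are the printed statements (BD05 Lemma 2.6 ∕ Thm 3.2, W. Zhang 2014
Prop 5.4 ∕ Lemma 7.3 ∕ (9.2); koly MEMO-v1–v2 U1–U4 and STUB-MISSTATED-3 §3 at p = 3), and the conclusion is the v2u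
(A1) conjunct VERBATIM. The proof is p460669's, with the good-level bookkeeping threaded (helpers reused from there).
`stub_levelRaisingAtThree_of_localGlobal_good` states the REGISTERED (v2u) stub signature as conclusion, from the five
inputs + (A6⁰)-on-good-levels frame-wise (CONDITIONAL; the owner assembles; (A6⁰) is itself parity-grade on good
levels — koly g12 `Method2ParityRank`, koly3a `ZhangInductionOddStart`).
HONEST FRAMING: structural; no definition, no named fact, no `sorry`; nothing is booked; the stub is NOT proved.
PARTITION: O2@3 (B10) × A1 × crux 19574 — none (reduction of a registered stub to named inputs; closes nothing; T7).

References: [cite: WZhang2014, Prop. 5.4, Lemma 7.3, §9 (9.1)–(9.3)] [cite: BertoliniDarmon2005, Lemma 2.6, Thm. 3.2].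
-/

noncomputable section

open scoped Classical

namespace Summit.BirchSwinnertonDyer.Rank1Residual.X11b.Three.Koly.Method2

open WeierstrassCurve NumberField IsDedekindDomain
  Literature.NumberTheory.EllipticCurves Literature.NumberTheory.EllipticCurves.ModularForms
  Literature.NumberTheory.GaloisRepresentations Module

variable (W : WeierstrassCurve ℚ) (K : Type) [Field K] [NumberField K] (c : K ≃ₐ[ℚ] K)

section RankLoweringGood

variable [W.IsElliptic] [W.IsGloballyMinimal] [Module (ZMod 3) (V3 W K)]

/-- **RANK LOWERING ON GOOD LEVELS for the canonical spaces `SelQ`, from (Cheb) + (Equiv) + (Line) + (Trans) + (Iso)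
asked at GOOD (non-scalar) unipotent-admissible primes only.** The conclusion is VERBATIM the (A1) conjunct of the
registered stub `stub_levelRaisingAtThree` (v2u): at a good level `n`, every non-zero `x ∈ SelQ n μ` is killed at
some new prime `q` with `insert q n` good, `SelQ (n∪{q}) μ ≤ SelQ n μ` of codimension exactly one, and
`SelQ (n∪{q}) (−μ) = SelQ n (−μ)`. Inputs: (Cheb) a non-zero class of `SelQ n μ` (`n` good) is detected by the
localisation at some GOOD unipotent-admissible `q ∉ n` [Zhang Lemma 7.3 ∕ BD05 Thm 3.2 ∕ koly U3 + STUB-MISSTATED-3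
§3]; at primes `q` with `Frob_q² ≠ 1` on `E[3]`: (Equiv) complex conjugation acts on `H¹(K_q, E[3])` by a scalar sign,
`loc_q` equivariantly [Zhang (9.2)]; (Line) the localisations of the Kummer-at-`q` classes are multiples of one local
class [BD05 L.2.6 ∕ koly U1]; (Trans) a multiple of a Kummer localisation that is ordinary vanishes [BD05 L.2.6 ∕
koly U4]; (Iso) on a good level, the localisations at `q` of two classes relaxed at `q` are proportional [Poitou–Tate;
Zhang Prop 5.4]. Proof as in `selQ_rankLowering_of_localGlobal` (p460669): forced sign, kernel description via the
one-prime step (zhang3-p1 p457790) + (Iso) + (Trans), codimension one by rank–nullity against the line; `insert q n`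
is good by `GoodLevel.insert`. CONDITIONAL on the five binders; nothing is booked.
[cite: WZhang2014, Prop. 5.4, Lemma 7.3, §9 (9.1)–(9.3)] [cite: BertoliniDarmon2005, Lemma 2.6, Thm. 3.2] -/
theorem selQ_rankLowering_on_of_localGlobal
    -- (Cheb) Čebotarev with the sign rule, producing a GOOD prime
    (hcheb : ∀ (n : Finset {q // IsUAdmissiblePrime W K q}) (μ : Bool) (x : V3 W K), GoodLevel W K n →
      x ∈ SelQ W K c n μ → x ≠ 0 →
      ∃ q : {q // IsUAdmissiblePrime W K q}, q ∉ n ∧ FrobSqNeOneAt W 3 q.1 ∧ ∃ v : HeightOneSpectrum (𝓞 K),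
        ((q : ℕ) : 𝓞 K) ∈ v.asIdeal ∧ (W.baseChange K).torsionLocMap (v.adicCompletion K) ((3 ^ 1 : ℕ) : ℤ) x ≠ 0)
    -- (Equiv) at a good prime, complex conjugation acts on H¹(K_q, E[3]) by the scalar sign of q, equivariantly
    (hequiv : ∀ q : {q // IsUAdmissiblePrime W K q}, FrobSqNeOneAt W 3 q.1 → ∃ s : Bool,
      ∀ v : HeightOneSpectrum (𝓞 K), ((q : ℕ) : 𝓞 K) ∈ v.asIdeal → ∀ z : V3 W K,
        (W.baseChange K).torsionLocMap (v.adicCompletion K) ((3 ^ 1 : ℕ) : ℤ) (conjAct W c ((3 ^ 1 : ℕ) : ℤ) z) =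
          sgn s • (W.baseChange K).torsionLocMap (v.adicCompletion K) ((3 ^ 1 : ℕ) : ℤ) z)
    -- (Line) at a good prime, the Kummer image is a line
    (hline : ∀ (q : {q // IsUAdmissiblePrime W K q}) (v : HeightOneSpectrum (𝓞 K)), FrobSqNeOneAt W 3 q.1 →
      ((q : ℕ) : 𝓞 K) ∈ v.asIdeal →
      ∃ ℓ, ∀ y ∈ selmerLocalKer (W.baseChange K) (v.adicCompletion K) ((3 ^ 1 : ℕ) : ℤ),
        ∃ a : ℤ, (W.baseChange K).torsionLocMap (v.adicCompletion K) ((3 ^ 1 : ℕ) : ℤ) y = a • ℓ)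
    -- (Trans) at a good prime, Kummer ∩ ordinary = 0
    (htrans : ∀ (q : {q // IsUAdmissiblePrime W K q}) (v : HeightOneSpectrum (𝓞 K)), FrobSqNeOneAt W 3 q.1 →
      ((q : ℕ) : 𝓞 K) ∈ v.asIdeal →
      ∀ y z : V3 W K, y ∈ selmerLocalKer (W.baseChange K) (v.adicCompletion K) ((3 ^ 1 : ℕ) : ℤ) →
        z ∈ (W.baseChange K).ordinaryLocalKer (v.adicCompletion K) ((3 ^ 1 : ℕ) : ℤ) →
        (∃ a : ℤ, (W.baseChange K).torsionLocMap (v.adicCompletion K) ((3 ^ 1 : ℕ) : ℤ) z =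
          a • (W.baseChange K).torsionLocMap (v.adicCompletion K) ((3 ^ 1 : ℕ) : ℤ) y) →
        (W.baseChange K).torsionLocMap (v.adicCompletion K) ((3 ^ 1 : ℕ) : ℤ) z = 0)
    -- (Iso) on a good level, at a good prime: Poitou–Tate isotropy of the image of the space relaxed at q
    (hiso : ∀ (n : Finset {q // IsUAdmissiblePrime W K q}) (q : {q // IsUAdmissiblePrime W K q}) (μ : Bool),
      GoodLevel W K n → FrobSqNeOneAt W 3 q.1 → q ∉ n →
      ∀ v : HeightOneSpectrum (𝓞 K), ((q : ℕ) : 𝓞 K) ∈ v.asIdeal →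
      ∀ y ∈ SelRelQ W K c (insert q n) {q} μ, ∀ z ∈ SelRelQ W K c (insert q n) {q} μ,
        (W.baseChange K).torsionLocMap (v.adicCompletion K) ((3 ^ 1 : ℕ) : ℤ) z ≠ 0 →
        ∃ a : ℤ, (W.baseChange K).torsionLocMap (v.adicCompletion K) ((3 ^ 1 : ℕ) : ℤ) y =
          a • (W.baseChange K).torsionLocMap (v.adicCompletion K) ((3 ^ 1 : ℕ) : ℤ) z) :
    ∀ (n : Finset {q // IsUAdmissiblePrime W K q}) (μ : Bool) (x : V3 W K),
      GoodLevel W K n → x ∈ SelQ W K c n μ → x ≠ 0 →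
      ∃ q : {q // IsUAdmissiblePrime W K q}, q ∉ n ∧ GoodLevel W K (insert q n) ∧
        x ∉ SelQ W K c (insert q n) μ ∧
        SelQ W K c (insert q n) μ ≤ SelQ W K c n μ ∧
        finrank (ZMod 3) (SelQ W K c (insert q n) μ) + 1 = finrank (ZMod 3) (SelQ W K c n μ) ∧
        SelQ W K c (insert q n) (!μ) = SelQ W K c n (!μ) := by
  intro n μ x hgood hx hx0
  obtain ⟨q, hqn, hqgood, v, hv, hvx⟩ := hcheb n μ x hgood hx hx0
  set loc := (W.baseChange K).torsionLocMap (v.adicCompletion K) ((3 ^ 1 : ℕ) : ℤ) with hloc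
  -- the place above the inert prime q is unique
  have hq0 : (q : ℕ) ≠ 0 := q.2.1.ne_zero
  have hqP : (Ideal.span {((q : ℕ) : 𝓞 K)}).IsPrime := q.2.2.2.2.2.1
  have huniq : ∀ v' : HeightOneSpectrum (𝓞 K), ((q : ℕ) : 𝓞 K) ∈ v'.asIdeal → v' = v :=
    fun v' hv' ↦ placesAbove_eq_of_isPrime_span K hqP hq0 hv hv'
  -- local classes are 3-torsion
  have h3loc : ∀ z : V3 W K, (3 : ℤ) • loc z = 0 := fun z ↦ by
    have h := zsmul_discreteH1_torsion ((3 ^ 1 : ℕ) : ℤ) (loc z)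
    simpa using h
  -- the sign of q is forced to be μ
  obtain ⟨s, hs⟩ := hequiv q hqgood
  have hsv : ∀ z : V3 W K, loc (conjAct W c ((3 ^ 1 : ℕ) : ℤ) z) = sgn s • loc z := hs v hv
  have hsμ : s = μ := by
    by_contra hne
    exact hvx (loc_eq_zero_of_sign_ne (conjAct W c _) loc hsv (conjAct_eq_of_mem_selQ W K c n μ hx) hne (h3loc x))
  -- hence loc_q kills every (−μ)-eigenclass
  have hkill : ∀ (m : Finset {q // IsUAdmissiblePrime W K q}) (y : V3 W K), y ∈ SelQ W K c m (!μ) → loc y = 0 :=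
    fun m y hy ↦ loc_eq_zero_of_sign_ne (conjAct W c _) loc hsv (conjAct_eq_of_mem_selQ W K c m (!μ) hy)
      (by rw [hsμ]; cases μ <;> decide) (h3loc y)
  -- zero classes are Kummer and ordinary
  have hKumTor : ∀ y : V3 W K, loc y = 0 →
      y ∈ selmerLocalKer (W.baseChange K) (v.adicCompletion K) ((3 ^ 1 : ℕ) : ℤ) := fun y hy ↦
    (W.baseChange K).torsionLocalKer_le_selmerLocalKer (v.adicCompletion K) _ (AddMonoidHom.mem_ker.mpr hy)
  have hOrdTor : ∀ y : V3 W K, loc y = 0 →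
      y ∈ (W.baseChange K).ordinaryLocalKer (v.adicCompletion K) ((3 ^ 1 : ℕ) : ℤ) := fun y hy ↦
    torsionLocalKer_le_ordinaryLocalKer W K _ _ (AddMonoidHom.mem_ker.mpr hy)
  -- the one-prime step (zhang3-p1), in membership form at the unique place v
  have hstep : ∀ (ν : Bool) (y : V3 W K),
      (y ∈ SelQ W K c (insert q n) ν ∧ y ∈ selmerLocalKer (W.baseChange K) (v.adicCompletion K) ((3 ^ 1 : ℕ) : ℤ)) ↔
      (y ∈ SelQ W K c n ν ∧ y ∈ (W.baseChange K).ordinaryLocalKer (v.adicCompletion K) ((3 ^ 1 : ℕ) : ℤ)) := by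
    intro ν y
    have h' := SetLike.ext_iff.mp (selQ_insert_inf_kummer_eq W K c n q hqn ν) y
    simp only [Submodule.mem_inf, AddSubgroup.mem_toZModSubmodule, AddSubgroup.mem_iInf] at h'
    constructor
    · rintro ⟨h1, h2⟩
      obtain ⟨h1', h2'⟩ := h'.mp ⟨h1, fun v' hv' ↦ by rw [huniq v' hv']; exact h2⟩
      exact ⟨h1', h2' v hv⟩
    · rintro ⟨h1, h2⟩
      obtain ⟨h1', h2'⟩ := h'.mpr ⟨h1, fun v' hv' ↦ by rw [huniq v' hv']; exact h2⟩
      exact ⟨h1', h2' v hv⟩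
  -- the KERNEL DESCRIPTION (Zhang Prop 5.4) on the μ-side
  have hker : ∀ y : V3 W K, y ∈ SelQ W K c (insert q n) μ ↔ (y ∈ SelQ W K c n μ ∧ loc y = 0) := by
    intro y
    constructor
    · intro hy
      have hmono := selRelQ_mono W K c (insert q n)
        (S := (∅ : Set {q // IsUAdmissiblePrime W K q})) (S' := {q}) (Set.empty_subset _) μ
      rw [← selQ_eq_selRelQ_empty] at hmono
      have hyR : y ∈ SelRelQ W K c (insert q n) {q} μ := hmono hy
      have hxR : x ∈ SelRelQ W K c (insert q n) {q} μ := relaxation_le W K c n q {q} μ hqn (Set.mem_singleton q) hx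
      have hy0 : loc y = 0 :=
        htrans q v hqgood hv x y (mem_selmerLocalKer_of_mem_selQ W K c n q hqn v hv μ hx)
          (mem_ordinaryLocalKer_of_mem_selQ_insert W K c n q v hv μ hy)
          (hiso n q μ hgood hqgood hqn v hv y hyR x hxR hvx)
      exact ⟨((hstep μ y).mp ⟨hy, hKumTor y hy0⟩).1, hy0⟩
    · rintro ⟨hy, hy0⟩
      exact ((hstep μ y).mpr ⟨hy, hOrdTor y hy0⟩).1
  -- codimension exactly one: rank–nullity against the line (Line), over ZMod 3
  letI : Module (ZMod 3) (discreteH1 (Field.absoluteGaloisGroup (v.adicCompletion K))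
      (AddSubgroup.torsionBy (localPoints (W.baseChange K) (v.adicCompletion K)) ((3 ^ 1 : ℕ) : ℤ))) :=
    AddCommGroup.zmodModule (fun z ↦ by
      have h := zsmul_discreteH1_torsion ((3 ^ 1 : ℕ) : ℤ) z
      rw [natCast_zsmul] at h
      simpa using h)
  set locZ := loc.toZModLinearMap 3 with hlocZ
  have hlocZ_apply : ∀ y : V3 W K, locZ y = loc y := fun _ ↦ rfl
  obtain ⟨ℓ, hℓ⟩ := hline q v hqgood hv
  haveI : FiniteDimensional (ZMod 3) (SelQ W K c n μ) := finiteDimensional_selQ W K c n μ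
  haveI : FiniteDimensional (ZMod 3) (Submodule.span (ZMod 3) ({ℓ} : Set _)) :=
    FiniteDimensional.span_of_finite (ZMod 3) (Set.finite_singleton ℓ)
  have hfr : finrank (ZMod 3) ↥(SelQ W K c n μ ⊓ LinearMap.ker locZ) + 1 = finrank (ZMod 3) (SelQ W K c n μ) := by
    refine ZhangInduction.finrank_inf_ker_add_one_of_line (SelQ W K c n μ) locZ (Submodule.span (ZMod 3) {ℓ})
      ((finrank_span_le_card _).trans (by simp)) ?_ ⟨x, hx, by rw [hlocZ_apply]; exact hvx⟩
    intro y hy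
    obtain ⟨a, ha⟩ := hℓ y (mem_selmerLocalKer_of_mem_selQ W K c n q hqn v hv μ hy)
    rw [Submodule.mem_span_singleton]
    exact ⟨(a : ZMod 3), by rw [hlocZ_apply, ha, Int.cast_smul_eq_zsmul]⟩
  have heq : SelQ W K c (insert q n) μ = SelQ W K c n μ ⊓ LinearMap.ker locZ := by
    ext y
    rw [Submodule.mem_inf, LinearMap.mem_ker, hlocZ_apply]
    exact hker y
  refine ⟨q, hqn, GoodLevel.insert W K hgood hqgood, fun hxq ↦ hvx ((hker x).mp hxq).2,
    fun y hy ↦ ((hker y).mp hy).1, by rw [heq]; exact hfr, ?_⟩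
  -- the (−μ)-side is untouched
  ext y
  constructor
  · intro hy
    exact ((hstep (!μ) y).mp ⟨hy, hKumTor y (hkill _ y hy)⟩).1
  · intro hy
    exact ((hstep (!μ) y).mpr ⟨hy, hOrdTor y (hkill _ y hy)⟩).1

end RankLoweringGood

/-! ## The registered (v2u) stub signature from the inputs, frame-wise (CONDITIONAL; the owner assembles) -/

section Stub

/-- **`stub_levelRaisingAtThree` — the REGISTERED v2u text (GOOD levels, koly g12 18:35Z) — FROM THE FIVE
LOCAL–GLOBAL INPUTS AT GOOD PRIMES + (A6⁰) ON GOOD LEVELS, supplied frame-wise.** The conclusion is the registered stub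
signature VERBATIM; the hypothesis asks, at every Hoffstein–Luo A1 frame and every complex conjugation `c ≠ 1` with the
`ZMod 3`-structure of `H¹(K, E[3])`: (Cheb) producing a GOOD prime, (Equiv) ∕ (Line) ∕ (Trans) at good primes, (Iso) on
good levels at good primes, and (A6⁰) on good levels [itself parity-grade there: koly g12 `Method2ParityRank`, or
dispensable above level ∅: koly3a `ZhangInductionOddStart`]. CONDITIONAL; nothing is booked; this seat does not claim
the stub. [cite: WZhang2014, Prop. 5.4, Lemma 7.3, Thm. 7.1, §9 (9.1)–(9.3)] [cite: BertoliniDarmon2005, Lemma 2.6, Thm. 3.2] -/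
theorem stub_levelRaisingAtThree_of_localGlobal_good
    (hLG : ∀ (W : WeierstrassCurve ℚ) [W.IsElliptic] [W.IsGloballyMinimal] [NeZero (W.conductorNorm ℤ)] (K : Type)
      [Field K] [NumberField K] (Dt : ModularParametrizationData W (W.conductorNorm ℤ)) (β : ℤ) (ι : K →+* ℂ),
      Summit.BirchSwinnertonDyer.Rank1Residual.ClassX11b W 3 → W.HasMultiplicativeReductionAtPrime 3 →
      Literature.NumberTheory.EllipticCurves.Rank1Residual.Surj W 3 →
      Literature.NumberTheory.EllipticCurves.Rank1Residual.Ram W 3 → ¬ 3 ∣ W.tamagawaProduct →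
      IsImaginaryQuadratic K → Odd (NumberField.discr K) → SatisfiesHeegnerHypothesis (W.conductorNorm ℤ) K →
      (W.quadraticTwist (NumberField.discr K : ℚ)).entireLFunction 1 ≠ 0 → NumberField.discr K ≠ -3 →
      (4 * (W.conductorNorm ℤ : ℤ)) ∣ β ^ 2 - NumberField.discr K → ¬ (3 : ℤ) ∣ Dt.c →
      ∀ (c : K ≃ₐ[ℚ] K), c ≠ 1 → ∀ [Module (ZMod 3) (V3 W K)],
      -- (Cheb)
      (∀ (n : Finset {q // IsUAdmissiblePrime W K q}) (μ : Bool) (x : V3 W K), GoodLevel W K n →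
        x ∈ SelQ W K c n μ → x ≠ 0 →
        ∃ q : {q // IsUAdmissiblePrime W K q}, q ∉ n ∧ FrobSqNeOneAt W 3 q.1 ∧ ∃ v : HeightOneSpectrum (𝓞 K),
          ((q : ℕ) : 𝓞 K) ∈ v.asIdeal ∧
            (W.baseChange K).torsionLocMap (v.adicCompletion K) ((3 ^ 1 : ℕ) : ℤ) x ≠ 0) ∧
      -- (Equiv)
      (∀ q : {q // IsUAdmissiblePrime W K q}, FrobSqNeOneAt W 3 q.1 → ∃ s : Bool,
        ∀ v : HeightOneSpectrum (𝓞 K), ((q : ℕ) : 𝓞 K) ∈ v.asIdeal → ∀ z : V3 W K,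
          (W.baseChange K).torsionLocMap (v.adicCompletion K) ((3 ^ 1 : ℕ) : ℤ) (conjAct W c ((3 ^ 1 : ℕ) : ℤ) z) =
            sgn s • (W.baseChange K).torsionLocMap (v.adicCompletion K) ((3 ^ 1 : ℕ) : ℤ) z) ∧
      -- (Line)
      (∀ (q : {q // IsUAdmissiblePrime W K q}) (v : HeightOneSpectrum (𝓞 K)), FrobSqNeOneAt W 3 q.1 →
        ((q : ℕ) : 𝓞 K) ∈ v.asIdeal →
        ∃ ℓ, ∀ y ∈ selmerLocalKer (W.baseChange K) (v.adicCompletion K) ((3 ^ 1 : ℕ) : ℤ),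
          ∃ a : ℤ, (W.baseChange K).torsionLocMap (v.adicCompletion K) ((3 ^ 1 : ℕ) : ℤ) y = a • ℓ) ∧
      -- (Trans)
      (∀ (q : {q // IsUAdmissiblePrime W K q}) (v : HeightOneSpectrum (𝓞 K)), FrobSqNeOneAt W 3 q.1 →
        ((q : ℕ) : 𝓞 K) ∈ v.asIdeal →
        ∀ y z : V3 W K, y ∈ selmerLocalKer (W.baseChange K) (v.adicCompletion K) ((3 ^ 1 : ℕ) : ℤ) →
          z ∈ (W.baseChange K).ordinaryLocalKer (v.adicCompletion K) ((3 ^ 1 : ℕ) : ℤ) →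
          (∃ a : ℤ, (W.baseChange K).torsionLocMap (v.adicCompletion K) ((3 ^ 1 : ℕ) : ℤ) z =
            a • (W.baseChange K).torsionLocMap (v.adicCompletion K) ((3 ^ 1 : ℕ) : ℤ) y) →
          (W.baseChange K).torsionLocMap (v.adicCompletion K) ((3 ^ 1 : ℕ) : ℤ) z = 0) ∧
      -- (Iso)
      (∀ (n : Finset {q // IsUAdmissiblePrime W K q}) (q : {q // IsUAdmissiblePrime W K q}) (μ : Bool),
        GoodLevel W K n → FrobSqNeOneAt W 3 q.1 → q ∉ n →
        ∀ v : HeightOneSpectrum (𝓞 K), ((q : ℕ) : 𝓞 K) ∈ v.asIdeal →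
        ∀ y ∈ SelRelQ W K c (insert q n) {q} μ, ∀ z ∈ SelRelQ W K c (insert q n) {q} μ,
          (W.baseChange K).torsionLocMap (v.adicCompletion K) ((3 ^ 1 : ℕ) : ℤ) z ≠ 0 →
          ∃ a : ℤ, (W.baseChange K).torsionLocMap (v.adicCompletion K) ((3 ^ 1 : ℕ) : ℤ) y =
            a • (W.baseChange K).torsionLocMap (v.adicCompletion K) ((3 ^ 1 : ℕ) : ℤ) z) ∧
      -- (A6⁰) on good even levels
      (∀ (n : Finset {q // IsUAdmissiblePrime W K q}), GoodLevel W K n → Even n.card →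
        finrank (ZMod 3) (SelQ W K c n true) + finrank (ZMod 3) (SelQ W K c n false) ≠ 0)) :
    ∀ (W : WeierstrassCurve ℚ) [W.IsElliptic] [W.IsGloballyMinimal] [NeZero (W.conductorNorm ℤ)] (K : Type)
      [Field K] [NumberField K] (Dt : ModularParametrizationData W (W.conductorNorm ℤ)) (β : ℤ) (ι : K →+* ℂ),
      Summit.BirchSwinnertonDyer.Rank1Residual.ClassX11b W 3 → W.HasMultiplicativeReductionAtPrime 3 →
      Literature.NumberTheory.EllipticCurves.Rank1Residual.Surj W 3 →
      Literature.NumberTheory.EllipticCurves.Rank1Residual.Ram W 3 → ¬ 3 ∣ W.tamagawaProduct →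
      IsImaginaryQuadratic K → Odd (NumberField.discr K) → SatisfiesHeegnerHypothesis (W.conductorNorm ℤ) K →
      (W.quadraticTwist (NumberField.discr K : ℚ)).entireLFunction 1 ≠ 0 → NumberField.discr K ≠ -3 →
      (4 * (W.conductorNorm ℤ : ℤ)) ∣ β ^ 2 - NumberField.discr K → ¬ (3 : ℤ) ∣ Dt.c →
      ∀ (c : K ≃ₐ[ℚ] K), c ≠ 1 → ∀ [Module (ZMod 3) (V3 W K)],
      -- (A1) rank lowering at one new GOOD (non-scalar) unipotent-admissible prime, on good levels, (9.1)–(9.2)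
      (∀ (n : Finset {q // IsUAdmissiblePrime W K q}) (μ : Bool) (x : V3 W K),
        GoodLevel W K n → x ∈ SelQ W K c n μ → x ≠ 0 →
        ∃ q : {q // IsUAdmissiblePrime W K q}, q ∉ n ∧ GoodLevel W K (insert q n) ∧
          x ∉ SelQ W K c (insert q n) μ ∧
          SelQ W K c (insert q n) μ ≤ SelQ W K c n μ ∧
          finrank (ZMod 3) (SelQ W K c (insert q n) μ) + 1 = finrank (ZMod 3) (SelQ W K c n μ) ∧
          SelQ W K c (insert q n) (!μ) = SelQ W K c n (!μ)) ∧
      -- (A6⁰) non-zero total rank at good even levels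
      (∀ (n : Finset {q // IsUAdmissiblePrime W K q}), GoodLevel W K n → Even n.card →
        finrank (ZMod 3) (SelQ W K c n true) + finrank (ZMod 3) (SelQ W K c n false) ≠ 0) := by
  intro W _ _ _ K _ _ Dt β ι hX hmult hsurj hram htam hK hodd hH hLt h3 hβ hc c hc1 _
  obtain ⟨hcheb, hequiv, hline, htrans, hiso, hA6⟩ :=
    hLG W K Dt β ι hX hmult hsurj hram htam hK hodd hH hLt h3 hβ hc c hc1
  exact ⟨selQ_rankLowering_on_of_localGlobal W K c hcheb hequiv hline htrans hiso, hA6⟩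

end Stub

/-! ## The registered v2w stub A — (A1) on good levels ONLY ((A6⁰) removed by the owner, koly g12 19:51Z) — from the
five inputs (no (A6⁰) hypothesis) -/

section StubV2w

/-- **`stub_levelRaisingAtThree` — the REGISTERED v2w text ((A1) on GOOD levels ONLY; the owner dropped the (A6⁰)
conjunct after koly3a's `ZhangInductionOddStart` ∕ koly g12's `Method2ParityRank`, the parity input being the separate
stub `stub_oddSelmerRankAtThree`) — FROM THE FIVE LOCAL–GLOBAL INPUTS AT GOOD PRIMES, frame-wise.** The conclusion is
the registered v2w stub signature VERBATIM; the hypothesis asks, at every Hoffstein–Luo A1 frame and every complex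
conjugation `c ≠ 1` with the `ZMod 3`-structure of `H¹(K, E[3])`: (Cheb) producing a good prime, (Equiv) ∕ (Line) ∕
(Trans) at good primes, (Iso) on good levels at good primes (koly MEMO-v8 §6 dictionary: (Cheb) = §4, (Equiv) =
§2(e), (Line) = §2(b), (Trans) = §2(c), (Iso) = §5 = Poitou–Tate, the one input with no tree supplier). CONDITIONAL;
nothing is booked; the owner assembles. [cite: WZhang2014, Prop. 5.4, Lemma 7.3, §9 (9.1)–(9.3)]
[cite: BertoliniDarmon2005, Lemma 2.6, Thm. 3.2] -/
theorem stub_levelRaisingAtThree_v2w_of_localGlobal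
    (hLG : ∀ (W : WeierstrassCurve ℚ) [W.IsElliptic] [W.IsGloballyMinimal] [NeZero (W.conductorNorm ℤ)] (K : Type)
      [Field K] [NumberField K] (Dt : ModularParametrizationData W (W.conductorNorm ℤ)) (β : ℤ) (ι : K →+* ℂ),
      Summit.BirchSwinnertonDyer.Rank1Residual.ClassX11b W 3 → W.HasMultiplicativeReductionAtPrime 3 →
      Literature.NumberTheory.EllipticCurves.Rank1Residual.Surj W 3 →
      Literature.NumberTheory.EllipticCurves.Rank1Residual.Ram W 3 → ¬ 3 ∣ W.tamagawaProduct →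
      IsImaginaryQuadratic K → Odd (NumberField.discr K) → SatisfiesHeegnerHypothesis (W.conductorNorm ℤ) K →
      (W.quadraticTwist (NumberField.discr K : ℚ)).entireLFunction 1 ≠ 0 → NumberField.discr K ≠ -3 →
      (4 * (W.conductorNorm ℤ : ℤ)) ∣ β ^ 2 - NumberField.discr K → ¬ (3 : ℤ) ∣ Dt.c →
      ∀ (c : K ≃ₐ[ℚ] K), c ≠ 1 → ∀ [Module (ZMod 3) (V3 W K)],
      -- (Cheb)
      (∀ (n : Finset {q // IsUAdmissiblePrime W K q}) (μ : Bool) (x : V3 W K), GoodLevel W K n →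
        x ∈ SelQ W K c n μ → x ≠ 0 →
        ∃ q : {q // IsUAdmissiblePrime W K q}, q ∉ n ∧ FrobSqNeOneAt W 3 q.1 ∧ ∃ v : HeightOneSpectrum (𝓞 K),
          ((q : ℕ) : 𝓞 K) ∈ v.asIdeal ∧
            (W.baseChange K).torsionLocMap (v.adicCompletion K) ((3 ^ 1 : ℕ) : ℤ) x ≠ 0) ∧
      -- (Equiv)
      (∀ q : {q // IsUAdmissiblePrime W K q}, FrobSqNeOneAt W 3 q.1 → ∃ s : Bool,
        ∀ v : HeightOneSpectrum (𝓞 K), ((q : ℕ) : 𝓞 K) ∈ v.asIdeal → ∀ z : V3 W K,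
          (W.baseChange K).torsionLocMap (v.adicCompletion K) ((3 ^ 1 : ℕ) : ℤ) (conjAct W c ((3 ^ 1 : ℕ) : ℤ) z) =
            sgn s • (W.baseChange K).torsionLocMap (v.adicCompletion K) ((3 ^ 1 : ℕ) : ℤ) z) ∧
      -- (Line)
      (∀ (q : {q // IsUAdmissiblePrime W K q}) (v : HeightOneSpectrum (𝓞 K)), FrobSqNeOneAt W 3 q.1 →
        ((q : ℕ) : 𝓞 K) ∈ v.asIdeal →
        ∃ ℓ, ∀ y ∈ selmerLocalKer (W.baseChange K) (v.adicCompletion K) ((3 ^ 1 : ℕ) : ℤ),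
          ∃ a : ℤ, (W.baseChange K).torsionLocMap (v.adicCompletion K) ((3 ^ 1 : ℕ) : ℤ) y = a • ℓ) ∧
      -- (Trans)
      (∀ (q : {q // IsUAdmissiblePrime W K q}) (v : HeightOneSpectrum (𝓞 K)), FrobSqNeOneAt W 3 q.1 →
        ((q : ℕ) : 𝓞 K) ∈ v.asIdeal →
        ∀ y z : V3 W K, y ∈ selmerLocalKer (W.baseChange K) (v.adicCompletion K) ((3 ^ 1 : ℕ) : ℤ) →
          z ∈ (W.baseChange K).ordinaryLocalKer (v.adicCompletion K) ((3 ^ 1 : ℕ) : ℤ) →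
          (∃ a : ℤ, (W.baseChange K).torsionLocMap (v.adicCompletion K) ((3 ^ 1 : ℕ) : ℤ) z =
            a • (W.baseChange K).torsionLocMap (v.adicCompletion K) ((3 ^ 1 : ℕ) : ℤ) y) →
          (W.baseChange K).torsionLocMap (v.adicCompletion K) ((3 ^ 1 : ℕ) : ℤ) z = 0) ∧
      -- (Iso)
      (∀ (n : Finset {q // IsUAdmissiblePrime W K q}) (q : {q // IsUAdmissiblePrime W K q}) (μ : Bool),
        GoodLevel W K n → FrobSqNeOneAt W 3 q.1 → q ∉ n →
        ∀ v : HeightOneSpectrum (𝓞 K), ((q : ℕ) : 𝓞 K) ∈ v.asIdeal →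
        ∀ y ∈ SelRelQ W K c (insert q n) {q} μ, ∀ z ∈ SelRelQ W K c (insert q n) {q} μ,
          (W.baseChange K).torsionLocMap (v.adicCompletion K) ((3 ^ 1 : ℕ) : ℤ) z ≠ 0 →
          ∃ a : ℤ, (W.baseChange K).torsionLocMap (v.adicCompletion K) ((3 ^ 1 : ℕ) : ℤ) y =
            a • (W.baseChange K).torsionLocMap (v.adicCompletion K) ((3 ^ 1 : ℕ) : ℤ) z)) :
    ∀ (W : WeierstrassCurve ℚ) [W.IsElliptic] [W.IsGloballyMinimal] [NeZero (W.conductorNorm ℤ)] (K : Type)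
      [Field K] [NumberField K] (Dt : ModularParametrizationData W (W.conductorNorm ℤ)) (β : ℤ) (ι : K →+* ℂ),
      Summit.BirchSwinnertonDyer.Rank1Residual.ClassX11b W 3 → W.HasMultiplicativeReductionAtPrime 3 →
      Literature.NumberTheory.EllipticCurves.Rank1Residual.Surj W 3 →
      Literature.NumberTheory.EllipticCurves.Rank1Residual.Ram W 3 → ¬ 3 ∣ W.tamagawaProduct →
      IsImaginaryQuadratic K → Odd (NumberField.discr K) → SatisfiesHeegnerHypothesis (W.conductorNorm ℤ) K →
      (W.quadraticTwist (NumberField.discr K : ℚ)).entireLFunction 1 ≠ 0 → NumberField.discr K ≠ -3 →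
      (4 * (W.conductorNorm ℤ : ℤ)) ∣ β ^ 2 - NumberField.discr K → ¬ (3 : ℤ) ∣ Dt.c →
      ∀ (c : K ≃ₐ[ℚ] K), c ≠ 1 → ∀ [Module (ZMod 3) (V3 W K)],
      -- (A1) rank lowering at one new GOOD (non-scalar) unipotent-admissible prime, on good levels, (9.1)–(9.2)
      (∀ (n : Finset {q // IsUAdmissiblePrime W K q}) (μ : Bool) (x : V3 W K),
        GoodLevel W K n → x ∈ SelQ W K c n μ → x ≠ 0 →
        ∃ q : {q // IsUAdmissiblePrime W K q}, q ∉ n ∧ GoodLevel W K (insert q n) ∧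
          x ∉ SelQ W K c (insert q n) μ ∧
          SelQ W K c (insert q n) μ ≤ SelQ W K c n μ ∧
          finrank (ZMod 3) (SelQ W K c (insert q n) μ) + 1 = finrank (ZMod 3) (SelQ W K c n μ) ∧
          SelQ W K c (insert q n) (!μ) = SelQ W K c n (!μ)) := by
  intro W _ _ _ K _ _ Dt β ι hX hmult hsurj hram htam hK hodd hH hLt h3 hβ hc c hc1 _
  obtain ⟨hcheb, hequiv, hline, htrans, hiso⟩ :=
    hLG W K Dt β ι hX hmult hsurj hram htam hK hodd hH hLt h3 hβ hc c hc1
  exact selQ_rankLowering_on_of_localGlobal W K c hcheb hequiv hline htrans hiso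

end StubV2w

end Summit.BirchSwinnertonDyer.Rank1Residual.X11b.Three.Koly.Method2

end
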